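import Summits.MatrixMultiplication.OmegaCensus.STPPKernelListerDataZ59
import Summits.MatrixMultiplication.OmegaCensus.STPPKernelListerSplit


/-!
# ω-census (abelian STPP census): kernel lister rows for `ℤ_59` (split form), file 24 of 43 (kernel computation)

HONEST FRAMING (pub-omega census; verbatim): lottery ticket; floor = certified bounds/negative ranges.
Census STRUCTURE (seat pub-omega-stpp-2 gen 29, 2026-08-29), family (b2).  One chunk of the root computation of the kernel lister at `n = 59` in split form
(`KLister.scanFirstSel2C`): light first blocks (part 4 of 8: 70 shapes), second blocks unrestricted.  Measured ≈ 0.2–1.2 s of kernel per thin first block (the `List.contains` selection itself costs 741·|sel1| comparisons).  Assembled in `STPPKernelListerCapstoneZ59.lean`.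
Pure finite computation; nothing here is progress on `ω`.
-/

namespace Summit.MatrixMultiplication.OmegaCensus.KLister

/-- First blocks of this file. [folklore] -/
def sel1Z59S24P4 : List Shape := [(2, 1, 13), (2, 13, 1), (13, 1, 2), (13, 2, 1), (26, 1, 1), (1, 1, 25), (1, 5, 5), (1, 25, 1), (5, 1, 5), (5, 5, 1), (25, 1, 1), (1, 1, 24), (1, 2, 12), (1, 3, 8), (1, 4, 6), (1, 6, 4), (1, 8, 3), (1, 12, 2), (1, 24, 1), (2, 1, 12), (2, 12, 1), (3, 1, 8), (3, 8, 1), (4, 1, 6), (4, 6, 1), (6, 1, 4), (6, 4, 1), (8, 1, 3), (8, 3, 1), (12, 1, 2), (12, 2, 1), (24, 1, 1), (1, 1, 23), (1, 23, 1), (23, 1, 1), (1, 1, 22), (1, 2, 11), (1, 11, 2), (1, 22, 1), (2, 1, 11), (2, 11, 1), (11, 1, 2), (11, 2, 1), (22, 1, 1), (1, 1, 21), (1, 3, 7), (1, 7, 3), (1, 21, 1), (3, 1, 7), (3, 7, 1), (7, 1, 3), (7, 3, 1), (21, 1, 1), (1, 1, 20), (1, 2, 10), (1, 4, 5), (1,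 5, 4), (1, 10, 2), (1, 20, 1), (2, 1, 10), (2, 10, 1), (4, 1, 5), (4, 5, 1), (5, 1, 4), (5, 4, 1), (10, 1, 2), (10, 2, 1), (20, 1, 1), (1, 1, 19), (1, 19, 1)]


set_option maxRecDepth 32768 in
set_option maxHeartbeats 4000000 in
/-- Rows of the kernel lister at `59` (split form) for this file's selections. [folklore] -/
theorem scanSel_Z59_S24P4 :
    scanFirstSel2C 59 deadZ59 (fun s => sel1Z59S24P4.contains s) (fun _ => true) chunksZ59 = true := by
  decide +kernel

end Summit.MatrixMultiplication.OmegaCensus.KLister
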